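import Literature.Geometry.Lorentzian.Stationary
import Literature.Geometry.Lorentzian.KillingHorizonShadowAlong
import Literature.Geometry.Lorentzian.GeodesicSpeed
import Literature.Geometry.Lorentzian.CausalityClosure
import Literature.Geometry.Lorentzian.CausalityPushUp
import Literature.Geometry.Lorentzian.CausalityOpennessProofs
import Literature.Geometry.Lorentzian.IdealPoints
import Literature.Geometry.Lorentzian.CoordinateFrames
import Literature.Geometry.Lorentzian.TrappedZeroEnergyRay
import Literature.Geometry.Lorentzian.LeviCivitaProofs
import HarnessLib

/-!
# Crux `HawkingExtensionIsKerr` (stmt-FinalStateConjecture-17840), line `SketchIdeator2` —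
# pointwise surface gravity of a Killing–causal collar

Helper file of the line lead (c3).  The line is closed modulo six Literature named facts, the
cheapest being the zeroth law `VacuumHorizonZerothLaw` (`∇_K K = κ K` on `𝓔⁺`, ONE constant `κ`).
Its POINTWISE half needs neither field equations nor `I⁺`-regularity nor horizon regularity, only
the causal collar of the crux: for `K` Killing on an open `U ⊇ 𝓔⁺`, null on `𝓔⁺`, with
`g(K, K) ≤ 0` on `U ∩ ⟨⟨M_ext⟩⟩`, `∇_K K ∥ K` at every point of `𝓔⁺` (`collarSurfaceGravity_pointwise`).
Proof: with `ℓ(v) := 2 g(∇_v K, K_p) = d(g(K,K))_p(v)`, (1) `ℓ(K_p) = 0` (skewness of `∇K`);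
(2) `ℓ ≥ 0` on future-timelike `v`: a `C¹` curve through `p` with velocity `δ v` has its points
`c(t)`, `t < 0` small, in `I⁻(p) ⊆ I⁻(M_ext)` (as `p ∈ ∂I⁻(M_ext)`, `I⁺(c t)` open) and in
`U ∩ I⁺(M_ext)`, where `g(K,K) ≤ 0 = g(K,K)(p)`; (3) a covector `≥ 0` on the future timelike cone
vanishing on the null `K_p` is a multiple of `g(K_p, ·)`; (4) Killing equation + non-degeneracy.
References: Wald 1984, §12.5 (12.5.2)–(12.5.5); Chruściel–Costa, arXiv:0806.0016, §2.3 (2.8);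
O'Neill 1983, Ch. 5, 9, 14.
-/

noncomputable section

set_option linter.dupNamespace false

namespace Summit.FinalStateConjecture.FinalStateConjecture.Theorems.HawkingExtensionIsKerr.SketchIdeator2

open Set Function Filter Bundle Literature.Geometry.Lorentzian
open scoped Manifold ContDiff Topology

/-! ## (A) Linear algebra: covectors non-negative on the timelike cone near a null vector -/

section LinearAlgebra

variable {V : Type*} [NormedAddCommGroup V] [NormedSpace ℝ V]

/-- **Supporting hyperplanes of the null cone.**  Let `β` be a symmetric bilinear form, `T` a
vector with `β(T,T) < 0` such that `β` is positive on `T^⊥ ∖ {0}` (Lorentzian signature), `N` a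
null vector with `β(T, N) < 0`, and `ℓ` a linear functional with `ℓ(N) = 0` which is non-negative on
every `v` with `β(v,v) < 0`, `β(T,v) < 0`.  Then `ℓ` vanishes on `N^⊥`: the vectors
`N + ε w + ε² λ T` (`w ⊥ N`, `λ` large) are such `v` for all small `ε ≠ 0` of either sign. -/
theorem covector_apply_eq_zero_of_orthogonal_null (β : V →L[ℝ] V →L[ℝ] ℝ)
    (hsymm : ∀ v w, β v w = β w v) (T : V)
    {N : V} (hN : β N N = 0) (hTN : β T N < 0) (ℓ : V →L[ℝ] ℝ) (hℓN : ℓ N = 0)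
    (hℓ : ∀ v, β v v < 0 → β T v < 0 → 0 ≤ ℓ v) {w : V} (hw : β N w = 0) : ℓ w = 0 := by
  set a : ℝ := β w w with ha
  set b : ℝ := β T N with hb
  set c : ℝ := β T w with hc
  set d : ℝ := β T T with hd
  set lam : ℝ := (|a| + 1) / (2 * (-b)) with hlam
  have hb0 : 0 < -b := by linarith
  have hlam0 : 0 < lam := by positivity
  have hbne : b ≠ 0 := ne_of_lt (by linarith)
  have hkey : a + 2 * lam * b = -(|a| + 1) + a := by
    rw [hlam]; field_simp; ring
  have hkey' : a + 2 * lam * b ≤ -1 := by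
    rw [hkey]; linarith [le_abs_self a]
  set v : ℝ → V := fun ε ↦ N + ε • w + (ε ^ 2 * lam) • T with hv
  have hβv : ∀ ε, β (v ε) (v ε) =
      ε ^ 2 * ((a + 2 * lam * b) + ε * (2 * lam * c) + ε ^ 2 * (lam ^ 2 * d)) := by
    intro ε
    have h1 : β N T = b := by rw [hb, hsymm]
    have h2 : β w N = 0 := by rw [hsymm, hw]
    have h3 : β w T = c := by rw [hc, hsymm]
    have h4 : β T w = c := rfl
    simp only [hv, map_add, map_smul, add_apply, FunLike.coe_smul, Pi.smul_apply,
      smul_eq_mul, hN, hw, h1, h2, h3]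
    rw [← ha, ← hb, ← hd]
    ring
  have hβTv : ∀ ε, β T (v ε) = b + ε * c + ε ^ 2 * (lam * d) := by
    intro ε
    simp only [hv, map_add, map_smul, smul_eq_mul]
    rw [← hb, ← hd]
    ring
  have hℓv : ∀ ε, ℓ (v ε) = ε * (ℓ w + ε * (lam * ℓ T)) := by
    intro ε
    simp only [hv, map_add, map_smul, smul_eq_mul, hℓN]
    ring
  have hP : ∀ᶠ ε : ℝ in 𝓝 0,
      (a + 2 * lam * b) + ε * (2 * lam * c) + ε ^ 2 * (lam ^ 2 * d) < 0 := by
    have hcont : Continuous fun ε : ℝ ↦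
        (a + 2 * lam * b) + ε * (2 * lam * c) + ε ^ 2 * (lam ^ 2 * d) := by fun_prop
    have h0 : (a + 2 * lam * b) + 0 * (2 * lam * c) + (0 : ℝ) ^ 2 * (lam ^ 2 * d) < 0 := by
      simpa using (by linarith : a + 2 * lam * b < 0)
    exact (hcont.tendsto 0).eventually_lt_const h0
  have hQ : ∀ᶠ ε : ℝ in 𝓝 0, b + ε * c + ε ^ 2 * (lam * d) < 0 := by
    have hcont : Continuous fun ε : ℝ ↦ b + ε * c + ε ^ 2 * (lam * d) := by fun_prop
    have h0 : b + 0 * c + (0 : ℝ) ^ 2 * (lam * d) < 0 := by simpa using (by linarith : b < 0)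
    exact (hcont.tendsto 0).eventually_lt_const h0
  have hsign : ∀ᶠ ε : ℝ in 𝓝[≠] 0, 0 ≤ ε * (ℓ w + ε * (lam * ℓ T)) := by
    have hne : ∀ᶠ ε : ℝ in 𝓝[≠] 0, ε ≠ 0 := self_mem_nhdsWithin
    filter_upwards [hne, nhdsWithin_le_nhds hP, nhdsWithin_le_nhds hQ] with ε hε hPε hQε
    rw [← hℓv]
    refine hℓ (v ε) ?_ ?_
    · rw [hβv]
      exact mul_neg_of_pos_of_neg (by positivity) hPε
    · rwa [hβTv]
  have hlin : Tendsto (fun ε : ℝ ↦ ℓ w + ε * (lam * ℓ T)) (𝓝 0) (𝓝 (ℓ w)) := by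
    have hcont : Continuous fun ε : ℝ ↦ ℓ w + ε * (lam * ℓ T) := by fun_prop
    simpa using hcont.tendsto 0
  have hge : 0 ≤ ℓ w := by
    have h1 : ∀ᶠ ε : ℝ in 𝓝[>] 0, 0 ≤ ℓ w + ε * (lam * ℓ T) := by
      have hpos : ∀ᶠ ε : ℝ in 𝓝[>] 0, 0 < ε := self_mem_nhdsWithin
      filter_upwards [hpos, nhdsWithin_mono 0 (fun ε (hε : 0 < ε) ↦ ne_of_gt hε) hsign]
        with ε hε hsε
      exact nonneg_of_mul_nonneg_right hsε hε
    exact ge_of_tendsto (hlin.mono_left nhdsWithin_le_nhds) h1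
  have hle : ℓ w ≤ 0 := by
    have h1 : ∀ᶠ ε : ℝ in 𝓝[<] 0, ℓ w + ε * (lam * ℓ T) ≤ 0 := by
      have hneg : ∀ᶠ ε : ℝ in 𝓝[<] 0, ε < 0 := self_mem_nhdsWithin
      filter_upwards [hneg, nhdsWithin_mono 0 (fun ε (hε : ε < 0) ↦ ne_of_lt hε) hsign]
        with ε hε hsε
      by_contra hcon
      push Not at hcon
      have : ε * (ℓ w + ε * (lam * ℓ T)) < 0 := mul_neg_of_neg_of_pos hε hcon
      linarith
    exact le_of_tendsto (hlin.mono_left nhdsWithin_le_nhds) h1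
  exact le_antisymm hle hge

/-- **A covector non-negative on the future timelike cone and vanishing on a null vector `K` is a
multiple of `β(K, ·)`.**  (Lorentzian signature: `β(T,T) < 0`, `β` positive on `T^⊥ ∖ {0}`.) -/
theorem covector_eq_smul_of_nonneg_timelikeCone (β : V →L[ℝ] V →L[ℝ] ℝ)
    (hsymm : ∀ v w, β v w = β w v) (T : V)
    (hpos : ∀ w, β T w = 0 → w ≠ 0 → 0 < β w w)
    {K : V} (hK : β K K = 0) (hK0 : K ≠ 0) (ℓ : V →L[ℝ] ℝ) (hℓK : ℓ K = 0)
    (hℓ : ∀ v, β v v < 0 → β T v < 0 → 0 ≤ ℓ v) :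
    ∃ c : ℝ, ∀ v, ℓ v = c * β K v := by
  have hTK : β T K ≠ 0 := fun h ↦ by
    have := hpos K h hK0
    linarith
  have hvan : ∀ w, β K w = 0 → ℓ w = 0 := by
    intro w hw
    rcases lt_or_gt_of_ne hTK with hlt | hgt
    · exact covector_apply_eq_zero_of_orthogonal_null β hsymm T hK hlt ℓ hℓK hℓ hw
    · have hN : β (-K) (-K) = 0 := by simp [hK]
      have hTN : β T (-K) < 0 := by simp only [map_neg]; linarith
      have hℓN : ℓ (-K) = 0 := by simp [hℓK]
      have hw' : β (-K) w = 0 := by simp [hw]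
      exact covector_apply_eq_zero_of_orthogonal_null β hsymm T hN hTN ℓ hℓN hℓ hw'
  have hKT : β K T ≠ 0 := by rwa [hsymm]
  refine ⟨ℓ T / β K T, fun v ↦ ?_⟩
  have hw : β K (v - (β K v / β K T) • T) = 0 := by
    simp only [map_sub, map_smul, smul_eq_mul]
    field_simp
    ring
  have h := hvan _ hw
  simp only [map_sub, map_smul, smul_eq_mul] at h
  field_simp
  field_simp at h
  linarith [h]

end LinearAlgebra

/-! ## (B) One-sided sign of a derivative -/

/-- If `h` is differentiable at `0` with `h 0 = 0` and `h ≤ 0` to the left of `0`, then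
`0 ≤ h'(0)`. -/
theorem deriv_nonneg_of_nonpos_left {h : ℝ → ℝ} {h' : ℝ} (hd : HasDerivAt h h' 0) (h0 : h 0 = 0)
    (hle : ∀ᶠ t in 𝓝[<] (0 : ℝ), h t ≤ 0) : 0 ≤ h' := by
  have ht := hd.tendsto_slope_zero_left
  refine ge_of_tendsto ht ?_
  have hneg : ∀ᶠ t : ℝ in 𝓝[<] 0, t < 0 := self_mem_nhdsWithin
  filter_upwards [hneg, hle] with t htneg hht
  rw [zero_add, h0, sub_zero, smul_eq_mul]
  exact mul_nonneg_of_nonpos_of_nonpos (inv_nonpos.mpr htneg.le) hht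


/-! ## (C) A future timelike curve with prescribed timelike velocity -/

section Curve

variable {E : Type*} [NormedAddCommGroup E] [NormedSpace ℝ E] {H : Type*} [TopologicalSpace H]
  {I : ModelWithCorners ℝ E H} {n : ℕ∞ω} {M : Type*} [TopologicalSpace M] [ChartedSpace H M]
  [IsManifold I ∞ M]

/-- **A `C¹` curve through an interior point `p` with velocity `δ • v` (`δ > 0`) for a given
future-timelike `v`, future timelike near `0`** — the chart-segment construction of
`exists_isFutureTimelikeCurveOn_Ioo_of_isInteriorPoint` with `T_p` replaced by `v`.
O'Neill 1983, Ch. 5, p. 146. -/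
theorem exists_isFutureTimelikeCurveOn_of_isTimelike (g : LorentzianMetric I n M)
    (τ : TimeOrientation g) {p : M} (hp : I.IsInteriorPoint p) {v : TangentSpace I p}
    (hv : g.val p v v < 0) (hvT : g.val p (τ.vectorField p) v < 0) :
    ∃ (c : ℝ → M) (ε δ : ℝ), 0 < ε ∧ 0 < δ ∧ c 0 = p ∧ velocity I c 0 = δ • v ∧
      ContMDiff 𝓘(ℝ, ℝ) I 1 c ∧ g.IsFutureTimelikeCurveOn τ c (Ioo (-ε) ε) := by
  set φ := extChartAt I p with hφdef
  set e : E := φ p with hedef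
  obtain ⟨V, hVt, hVo, hpV⟩ : ∃ V, V ∩ range I ⊆ φ.target ∧ IsOpen V ∧ e ∈ V := by
    obtain ⟨V, hVo, hpV, hV⟩ := mem_nhdsWithin.mp (extChartAt_target_mem_nhdsWithin (I := I) p)
    exact ⟨V, hV, hVo, hpV⟩
  have hei : e ∈ interior (range I) := hp
  obtain ⟨r, hr, hball⟩ :=
    Metric.mem_nhds_iff.mp ((hVo.inter isOpen_interior).mem_nhds ⟨hpV, hei⟩)
  have hballt : Metric.ball e r ⊆ φ.target := fun x hx ↦
    hVt ⟨(hball hx).1, interior_subset (hball hx).2⟩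
  have hballi : ∀ x ∈ Metric.ball e r, range I ∈ 𝓝 x := fun x hx ↦
    mem_interior_iff_mem_nhds.mp (hball hx).2
  have het : e ∈ φ.target := hballt (Metric.mem_ball_self hr)
  have hq : φ.symm e = p := extChartAt_to_inv p
  set w : E := mfderiv I 𝓘(ℝ, E) φ p v with hwdef
  set δ : ℝ := r / (2 * (‖w‖ + 1)) with hδdef
  have hδ : 0 < δ := by positivity
  have hδw : δ * ‖w‖ < r := by
    rw [hδdef, div_mul_eq_mul_div, div_lt_iff₀ (by positivity)]
    nlinarith [norm_nonneg w]
  set f : ℝ → E := fun t ↦ e + (δ * Real.sin t) • w with hfdef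
  have hfball : ∀ t, f t ∈ Metric.ball e r := fun t ↦ by
    rw [Metric.mem_ball, dist_eq_norm, hfdef]
    simp only [add_sub_cancel_left, norm_smul, Real.norm_eq_abs, abs_mul, abs_of_pos hδ]
    calc δ * |Real.sin t| * ‖w‖ ≤ δ * 1 * ‖w‖ := by
          gcongr; exact Real.abs_sin_le_one t
      _ < r := by rw [mul_one]; exact hδw
  have hfd : ∀ t, HasDerivAt f ((δ * Real.cos t) • w) t := fun t ↦
    (((Real.hasDerivAt_sin t).const_mul δ).smul_const w).const_add e
  have hfC : ContDiff ℝ 1 f := by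
    rw [hfdef]; fun_prop
  set c : ℝ → M := φ.symm ∘ f with hcdef
  have hc : ContMDiff 𝓘(ℝ, ℝ) I 1 c :=
    (contMDiffOn_extChartAt_symm (n := 1) p).comp_contMDiff hfC.contMDiff
      (fun t ↦ hballt (hfball t))
  have hvel : ∀ t, velocity I c t = (δ * Real.cos t) • mfderiv 𝓘(ℝ, E) I φ.symm (f t) w := by
    intro t
    have h1 : MDifferentiableAt 𝓘(ℝ, E) I φ.symm (f t) :=
      (mdifferentiableWithinAt_extChartAt_symm (hballt (hfball t))).mdifferentiableAt
        (hballi _ (hfball t))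
    have h2 : HasMFDerivAt 𝓘(ℝ, ℝ) 𝓘(ℝ, E) f t
        (ContinuousLinearMap.toSpanSingleton ℝ ((δ * Real.cos t) • w)) :=
      hasMFDerivAt_iff_hasFDerivAt.mpr (hfd t).hasFDerivAt
    have h3 := h1.hasMFDerivAt.comp t h2
    have h4 : ContinuousLinearMap.toSpanSingleton ℝ ((δ * Real.cos t) • w) (1 : ℝ) =
        (δ * Real.cos t) • w := by
      rw [ContinuousLinearMap.toSpanSingleton_apply, one_smul]
    unfold velocity
    rw [h3.mfderiv]
    exact (congrArg (mfderiv 𝓘(ℝ, E) I φ.symm (f t)) h4).trans (map_smul _ _ _)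
  have hf0 : f 0 = e := by simp [hfdef]
  have hc0 : c 0 = p := by simp [hcdef, hf0, hq]
  have hAw : mfderiv 𝓘(ℝ, E) I φ.symm e w = v := by
    have := mfderivWithin_extChartAt_symm_comp_mfderiv_extChartAt (I := I) het
    rw [mfderivWithin_of_mem_nhds (mem_interior_iff_mem_nhds.mp hei), hq] at this
    exact DFunLike.congr_fun this v
  have hv0 : velocity I c 0 = δ • v := by
    rw [hvel 0, Real.cos_zero, mul_one, hf0, hAw]
    rfl
  have hL := LorentzianMetric.continuous_tangentLift hc
  have hT : Continuous (fun t ↦ (⟨c t, τ.vectorField (c t)⟩ : TangentBundle I M)) :=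
    (contMDiff_zero_iff.mp (τ.contMDiff.of_le bot_le)).comp hc.continuous
  have hQ := g.continuous_val_of_continuous hc.continuous hL hL
  have hP := g.continuous_val_of_continuous hc.continuous hT hL
  have hQ0 : g.val (c 0) (velocity I c 0) (velocity I c 0) < 0 := by
    have key : ∀ x : M, x = p → ∀ u : TangentSpace I x, u = δ • v → g.val x u u < 0 := by
      rintro x rfl u rfl
      exact LorentzianMetric.IsTimelike.smul hv hδ.ne'
    exact key (c 0) hc0 _ hv0
  have hP0 : g.val (c 0) (τ.vectorField (c 0)) (velocity I c 0) < 0 := by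
    have key : ∀ x : M, x = p → ∀ u : TangentSpace I x, u = δ • v →
        g.val x (τ.vectorField x) u < 0 := by
      rintro x rfl u rfl
      rw [map_smul, smul_eq_mul]
      exact mul_neg_of_pos_of_neg hδ hvT
    exact key (c 0) hc0 _ hv0
  obtain ⟨ε, hε, hεb⟩ := Metric.eventually_nhds_iff_ball.mp
    (((hQ.tendsto 0).eventually_lt_const hQ0).and ((hP.tendsto 0).eventually_lt_const hP0))
  refine ⟨c, ε, δ, hε, hδ, hc0, hv0, hc, fun t ht ↦ ?_⟩
  have htb : t ∈ Metric.ball (0 : ℝ) ε := by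
    rw [Real.ball_eq_Ioo, zero_sub, zero_add]; exact ht
  obtain ⟨hQt, hPt⟩ := hεb t htb
  exact ⟨hc.mdifferentiableAt one_ne_zero, hQt, LorentzianMetric.IsTimelike.isCausal g hQt, hPt⟩

end Curve


/-! ## (D) Pointwise surface gravity of a Killing–causal collar -/

/-- **Pointwise surface gravity of a Killing–causal collar (no field equations, no horizon
regularity).**  Let `𝓑` be a stationary asymptotically flat black-hole space-time, `K` a Killing
field on an open `U ⊇ 𝓔⁺` which is null on `𝓔⁺` and causal-or-zero on the collar
`U ∩ ⟨⟨M_ext⟩⟩` (`g(K, K) ≤ 0` there).  Then at every `p ∈ 𝓔⁺` the vector `∇_K K` is a multiple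
of `K`: `∇_K K (p) = κ_p K(p)`.  (The zeroth law — one constant `κ` — is the named fact
`VacuumHorizonZerothLaw`; this is its pointwise half in the collar setting of crux
`HawkingExtensionIsKerr`, where `g(K, K) < 0` on `U ∩ ⟨⟨M_ext⟩⟩`.)  Wald 1984, §12.5,
(12.5.2)–(12.5.5); Chruściel–Costa 2008, §2.3 (2.8). -/
theorem collarSurfaceGravity_pointwise (𝓑 : StationaryAFBlackHole.{0}) [𝓑.metric.HasLeviCivita]
    {U : Set 𝓑.carrier} {K : Π x : 𝓑.carrier, TangentSpace (𝓡 4) x}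
    (hU : IsOpen U) (hHU : 𝓑.horizon ⊆ U)
    (hKon : 𝓑.metric.toPseudoRiemannianMetric.IsKillingFieldOn K U)
    (hnull : ∀ p ∈ 𝓑.horizon, 𝓑.metric.val p (K p) (K p) = 0)
    (hKc : ∀ x ∈ U ∩ 𝓑.doc, 𝓑.metric.val x (K x) (K x) ≤ 0) :
    ∀ p ∈ 𝓑.horizon, ∃ κ : ℝ, 𝓑.metric.leviCivita K p (K p) = κ • K p := by
  intro p hp
  have hpU : p ∈ U := hHU hp
  have hpfr : p ∈ frontier (𝓑.metric.chronologicalPast 𝓑.timeOrientation 𝓑.Mext) := hp.1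
  have hpfut : p ∈ 𝓑.metric.chronologicalFuture 𝓑.timeOrientation 𝓑.Mext := hp.2
  -- the trivial case `K p = 0`
  by_cases hK0 : K p = 0
  · exact ⟨0, by rw [hK0, map_zero, smul_zero]⟩
  -- the tangent space at `p` is the model space `E4`; read the metric and `∇K` at `p` there
  set β : E4 →L[ℝ] E4 →L[ℝ] ℝ := 𝓑.metric.val p with hβdef
  set A : E4 →L[ℝ] E4 := 𝓑.metric.leviCivita K p with hAdef
  set Kp : E4 := K p with hKpdef
  -- the covector `ℓ(v) = 2 g(∇_v K, K_p)` (the differential of `g(K, K)` at `p`)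
  set ℓ : E4 →L[ℝ] ℝ := (2 : ℝ) • (β.flip Kp).comp A with hℓdef
  have hℓapply : ∀ v, ℓ v = 2 * 𝓑.metric.val p (𝓑.metric.leviCivita K p v) (K p) := by
    intro v
    show ((2 : ℝ) • (β.flip Kp).comp A) v = _
    rw [smul_apply, ContinuousLinearMap.comp_apply, ContinuousLinearMap.flip_apply]
    rfl
  -- (1) `ℓ(K_p) = 0` (skewness of `∇K`)
  have hℓK : ℓ (K p) = 0 := by
    rw [hℓapply, hKon.val_leviCivita_self hpU (K p), mul_zero]
  -- (2) `ℓ(v) ≥ 0` for every future-timelike `v`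
  have hℓnonneg : ∀ v : E4, 𝓑.metric.val p v v < 0 →
      𝓑.metric.val p (𝓑.timeOrientation.vectorField p) v < 0 → 0 ≤ ℓ v := by
    intro v hv hvT
    obtain ⟨c, ε, δ, hε, hδ, hc0, hcv, hc1, hctl⟩ :=
      exists_isFutureTimelikeCurveOn_of_isTimelike 𝓑.metric 𝓑.timeOrientation
        (BoundarylessManifold.isInteriorPoint (I := 𝓡 4)) hv hvT
    subst hc0
    -- the derivative of `t ↦ g(K, K)(c t)` at `0` is `δ ℓ(v)`
    have hKd := hKon.mdifferentiableAt hU hpU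
    have hcd : MDifferentiableAt 𝓘(ℝ, ℝ) (𝓡 4) c 0 := hc1.mdifferentiableAt one_ne_zero
    have hlift := mdifferentiableAt_lift_comp (I := 𝓡 4) (X := K) (γ := c) (t₀ := 0) hKd hcd
    have hcov : 𝓑.metric.toPseudoRiemannianMetric.IsCompatible 𝓑.metric.leviCivita :=
      (PseudoRiemannianMetric.isLeviCivita_leviCivita_holds
        (g := 𝓑.metric.toPseudoRiemannianMetric)).2
    have hD := 𝓑.metric.toPseudoRiemannianMetric.hasDerivAt_val_apply_along hcov hlift hlift
    rw [covariantDerivAlong_comp_holds 𝓑.metric.leviCivita hcd hKd, hcv] at hD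
    have hderiv : HasDerivAt (fun t ↦ 𝓑.metric.val (c t) (K (c t)) (K (c t))) (δ * ℓ v) 0 := by
      convert hD using 1
      rw [hℓapply, map_smul, 𝓑.metric.symm (c 0) (K (c 0))]
      simp only [map_smul, FunLike.coe_smul, Pi.smul_apply, smul_eq_mul]
      ring
    -- `g(K, K)(c 0) = 0` and `g(K, K)(c t) ≤ 0` for `t < 0` small: those points lie in `U ∩ doc`
    have h0 : 𝓑.metric.val (c 0) (K (c 0)) (K (c 0)) = 0 := hnull _ hp
    have hleft : ∀ᶠ t in 𝓝[<] (0 : ℝ), 𝓑.metric.val (c t) (K (c t)) (K (c t)) ≤ 0 := by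
      have hopen : IsOpen (U ∩ 𝓑.metric.chronologicalFuture 𝓑.timeOrientation 𝓑.Mext) :=
        hU.inter (LorentzianMetric.isOpen_chronologicalFuture_of_boundaryless
          𝓑.metric 𝓑.timeOrientation _)
      have hmem : ∀ᶠ t in 𝓝 (0 : ℝ),
          c t ∈ U ∩ 𝓑.metric.chronologicalFuture 𝓑.timeOrientation 𝓑.Mext :=
        hc1.continuous.continuousAt.preimage_mem_nhds (hopen.mem_nhds ⟨hpU, hpfut⟩)
      have hIoo : ∀ᶠ t in 𝓝[<] (0 : ℝ), t ∈ Ioo (-ε) 0 := Ioo_mem_nhdsLT (by linarith)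
      filter_upwards [nhdsWithin_le_nhds hmem, hIoo] with t htUF ht
      obtain ⟨htU, htF⟩ := htUF
      refine hKc (c t) ⟨htU, htF, ?_⟩
      -- `c t ∈ I⁻(M_ext)`: `c 0 ∈ I⁺(c t)` is in the closure of the past set `I⁻(M_ext)`
      have hpt : c 0 ∈ 𝓑.metric.chronologicalFuture 𝓑.timeOrientation {c t} :=
        ⟨c t, rfl, c, t, 0, ht.2, hctl.mono (Icc_subset_Ioo ht.1 hε), rfl, rfl⟩
      obtain ⟨p', hp'F, hp'P⟩ :
          (𝓑.metric.chronologicalFuture 𝓑.timeOrientation {c t} ∩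
            𝓑.metric.chronologicalPast 𝓑.timeOrientation 𝓑.Mext).Nonempty :=
        mem_closure_iff_nhds.mp (frontier_subset_closure hpfr) _
          ((LorentzianMetric.isOpen_chronologicalFuture_of_boundaryless 𝓑.metric
            𝓑.timeOrientation {c t}).mem_nhds hpt)
      exact LorentzianMetric.mem_chronologicalPast_trans hp'P
        (LorentzianMetric.mem_chronologicalPast_of_mem_chronologicalFuture hp'F)
    have hsign := deriv_nonneg_of_nonpos_left hderiv h0 hleft
    exact nonneg_of_mul_nonneg_right hsign hδ
  -- (3) `ℓ` is a multiple of `g(K_p, ·)`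
  obtain ⟨a, ha⟩ := covector_eq_smul_of_nonneg_timelikeCone β (𝓑.metric.symm p)
    (𝓑.timeOrientation.vectorField p : E4)
    (fun w hw hw0 ↦ 𝓑.metric.pos_of_orthogonal p _ w (𝓑.timeOrientation.isTimelike p) hw hw0)
    (K := Kp) (hnull p hp) hK0 ℓ hℓK hℓnonneg
  -- (4) `g(∇_K K, w) = -g(∇_w K, K) = -(a/2) g(K, w)` for all `w`, and non-degeneracy
  have key : ∀ w, 𝓑.metric.val p (𝓑.metric.leviCivita K p (K p)) w =
      -(a / 2) * 𝓑.metric.val p (K p) w := by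
    intro w
    have h1 := hKon.val_leviCivita_add hpU (K p) w
    have h2 : 𝓑.metric.val p (K p) (𝓑.metric.leviCivita K p w) =
        𝓑.metric.val p (𝓑.metric.leviCivita K p w) (K p) := 𝓑.metric.symm p _ _
    have h3 := ha w
    have h4 : (β Kp) w = 𝓑.metric.val p (K p) w := rfl
    rw [hℓapply, h4] at h3
    linarith
  refine ⟨-(a / 2), ?_⟩
  have hzero : 𝓑.metric.leviCivita K p (K p) - (-(a / 2)) • K p = 0 := by
    refine 𝓑.metric.nondegenerate p _ (fun w ↦ ?_)
    rw [map_sub, map_smul, sub_apply, smul_apply, smul_eq_mul, key w]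
    ring
  exact sub_eq_zero.mp hzero


/-- **Registered sub-goal form** (closed statement, crux stmt-FinalStateConjecture-17840): the
pointwise surface gravity of a Killing–causal collar, `collarSurfaceGravity_pointwise` with all
binders universally quantified. -/
theorem stub_collarSurfaceGravity_pointwise : ∀ (𝓑 : StationaryAFBlackHole.{0}) [𝓑.metric.HasLeviCivita] (U : Set 𝓑.carrier) (K : Π x : 𝓑.carrier, TangentSpace (𝓡 4) x), IsOpen U → 𝓑.horizon ⊆ U → 𝓑.metric.toPseudoRiemannianMetric.IsKillingFieldOn K U → (∀ p ∈ 𝓑.horizon, 𝓑.metric.val p (K p) (K p) = 0) → (∀ x ∈ U ∩ 𝓑.doc, 𝓑.metric.val x (K x) (K x) ≤ 0) → ∀ p ∈ 𝓑.horizon, ∃ κ : ℝ, 𝓑.metric.leviCivita K p (K p) = κ • K p :=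
  fun 𝓑 _ _ _ hU hHU hKon hnull hKc ↦ collarSurfaceGravity_pointwise 𝓑 hU hHU hKon hnull hKc

end Summit.FinalStateConjecture.FinalStateConjecture.Theorems.HawkingExtensionIsKerr.SketchIdeator2

end
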